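import Summits.BirchSwinnertonDyer.BirchSwinnertonDyer.Theorems.ManinLocalTwoThreeVeluFiveKummerLemma
import Summits.BirchSwinnertonDyer.BirchSwinnertonDyer.Theorems.ManinLocalTwoThreeSplitFiveVeluQuotient
import Literature.NumberTheory.EllipticCurves.KubertTateFiveVeluKernel
import Literature.NumberTheory.EllipticCurves.IsogenyDescentKummerElement
import Literature.NumberTheory.EllipticCurves.IsogenyDualKernelCyclotomic
import Literature.NumberTheory.EllipticCurves.SelmerCorankProofs
import HarnessLib

/-!
# Road δ, part 7: the Kummer step E-es-242 `VeluFiveRationalFiveTorsion` is a theorem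

`veluFive b = E'_{b,1} = E_{b,1}/⟨(0,0)⟩` (Vélu quotient of the Tate normal form `E_{b,1} = kubertTateFive b 1`,
tree `veluFive_eq_kubertTateFive'`).  **If `veluFive b` (elliptic) has a rational point of order `5`, then `b` is a
fifth power in `ℚ`.**  This closes row E-es-242 of the node `ShimuraFiveModuli`; together with the landed E-es-241
(`splitFiveTorsionIsVeluQuotient_holds`) it makes E-es-239 `SplitFiveTorsionModuli` and **L5 = E-es-235
`SplitFiveTorsionRootNumberLaw`** theorems (§3: `splitFiveTorsionModuli_holds`, `splitFiveTorsionRootNumberLaw_holds`,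
through the landed edges `splitFiveTorsionModuli_of`, `splitFiveTorsionRootNumberLaw_of_split`).  BSD is not proved
here; C2/C3 remain OPEN ⟸ CDT.

## Proof (relative Kummer theory of the dual isogeny, base-point free)

Let `φ : E → E'` be Vélu's `5`-isogeny (`fiveIsogeny b 1`, kernel `⟨T̄⟩`, `T̄ = (0,0)`), `ψ : E' → E` its dual
(`ψφ = [5]`, `φψ = [5]`), `f = f_T = xy − x² + y ∈ ℚ(E)` the Kummer function with `div f = 5(T̄) − 5(O)`
(tree `kummerFn`, `ord_kummerFn`).  Let `P' ∈ E'(ℚ)` have order `5` and `P = ι P' ∈ E'(ℚ̄)` (Galois fixed).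

1. `ψ P ≠ O` (`dual_apply_ne_zero_of_fixed`): otherwise `P = φ S` with `S ∈ E[5]`; as `P` is fixed,
   `σS − S ∈ ker φ = ⟨T̄⟩`, so `ζ = e₅(S, T̄)` is `Γ_ℚ`-fixed (`e₅(σS, σT̄) = σ e₅(S, T̄)`, `σT̄ = T̄`,
   bilinearity, `e₅(⟨T̄⟩, T̄) = 1`) with `ζ⁵ = 1`, so `ζ = 1` (`μ₅(F) = 1`), so `S ∈ ⟨T̄⟩ = ker φ` and `P = O`.
2. `Q = ψ P` lies in `ker φ = ⟨T̄⟩` (`φ Q = 5P = O`) and is `≠ O`, so it GENERATES `ker φ`; hence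
   `2T̄ = a₁ Q`, `−T̄ = a₂ Q`, and φ-preimages `R_i` of `a_i P` satisfy `5 R₁ = 2T̄`, `5 R₂ = −T̄` with cocycles
   `σR_i − R_i ∈ ker φ = ⟨T̄⟩`, which pair trivially with `T̄`.
3. BASE-POINT-FREE relative Kummer lemma (`exists_pow_mul_eq_of_weilPairing_eq'` of the companion file
   `ManinLocalTwoThreeVeluFiveKummerLemma`, the tree's `exists_pow_mul_eq_of_weilPairing_eq` without its auxiliary
   rational point `Q₀` — unavailable in rank `0`): equal cocycles force `f(5R₁) = u⁵ f(5R₂)`, `u ∈ ℚˣ`.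
4. `−T̄ = (0, b)`, `2T̄ = (b, y)` with `y ∈ {0, b²}` (kernel coordinates, `mem_ker_fiveIsogeny_imp`; no chord–tangent
   computation), and `f(0,b) = b`, `f(b,0) = −b²`, `f(b,b²) = b³`: so `−b = u⁵` or `b² = u⁵`; either way `b ∈ ℚ⁵`.

Typing notes. (i) §2 is written over an arbitrary field `F` of characteristic `0` with the hypothesis `μ₅(F) = 1`
(`hμ`), and specialised to `ℚ` only in §3 (`eq_one_of_pow_five_eq_one_of_forall_galRingHom`): this way the only
`F`-algebra structure on `F̄` that is ever elaborated is the library's `AlgebraicClosure.instAlgebra`, and no instance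
attribute has to be removed or re-prioritised. (ii) The generic library bakes the classical `DecidableEq K` into the
group structure on `E(K)` (e.g. in `toGeomPoints`), while the node's statement over `ℚ` carries the computable
instance; `addOrderOf_toGeomPoints_eq` (companion file) bridges the two (`Subsingleton.elim`).

## References

* [SilvermanAEC2009] J. H. Silverman, *AEC*, 2nd ed., III.§8 (Prop. III.8.1), Thm. X.1.1(c) (proof), X.4.9,
  Exercise 10.1(c).
* [Fisher2001FiveSevenDescent] T. Fisher, JEMS 3 (2001), §1.
* [Kubert1976] D. S. Kubert, Table 3 (`N = 5`); [Knapp1993] A. Knapp, *Elliptic Curves*, §V.5 (5.31).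
* [Velu1971] J. Vélu, C. R. Acad. Sci. Paris 273 (1971); [Washington1997] L. Washington, *Cyclotomic Fields*, Thm. 2.5.
-/

set_option linter.dupNamespace false

noncomputable section

open scoped Classical


universe u

namespace Summit.BirchSwinnertonDyer.BirchSwinnertonDyer.Theorems.ManinLocalTwoThree.ShimuraFive

open WeierstrassCurve WeierstrassCurve.geomPoints WeierstrassCurve.Isogeny Field
  Literature.NumberTheory.EllipticCurves Literature.NumberTheory.EllipticCurves.WeierstrassFunctionField
  Literature.NumberTheory.EllipticCurves.KubertTateKummer Literature.NumberTheory.EllipticCurves.KubertTateVelu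
  Summit.BirchSwinnertonDyer.Rank1Residual.ManinAdditive
  Summit.BirchSwinnertonDyer.Rank1Residual.ManinAdditive.EsG43
  Summit.BirchSwinnertonDyer.Rank1Residual.ManinAdditive.EsG44

/-! ## §2 The Tate normal form `E_{b,1}` over a field `F` of characteristic `0`: the dual pair, the kernel generator,
the two evaluation points, the Kummer step (generic in `F`, so that no `ℚ`-algebra instance on `F̄` is ever chosen) -/

section TateNormalForm

variable {F : Type u} [Field F] [CharZero F] (b : F) [hE : (kubertTateFive b (1 : F)).IsElliptic]

/-- The dual `ψ` of Vélu's `φ : E_{b,1} → E'_{b,1}`, `ψφ = [5]`. [cite: SilvermanAEC2009, Thm. III.6.1(a)] -/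
theorem exists_dual_fiveIsogeny :
    ∃ ψ : Isogeny (kubertTateFive' b (1 : F)) (kubertTateFive b (1 : F)),
      ∀ P, ψ (fiveIsogeny b (1 : F) P) = ((5 : ℕ) : ℤ) • P := by
  obtain ⟨ψ, hψ⟩ := (fiveIsogeny b (1 : F)).exists_dual_of_isElliptic
  refine ⟨ψ, fun P ↦ ?_⟩
  rw [hψ, Isogeny.degree, natCard_ker_fiveIsogeny]

variable (ψ : Isogeny (kubertTateFive' b (1 : F)) (kubertTateFive b (1 : F)))
  (hψ : ∀ P, ψ (fiveIsogeny b (1 : F) P) = ((5 : ℕ) : ℤ) • P)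

include hψ in
/-- `φψ = [5]` on `E'(ℚ̄)` (`φ` is onto). [cite: SilvermanAEC2009, Thm. III.6.2(a)] -/
theorem fiveIsogeny_dual_apply (Q : geomPoints (kubertTateFive' b (1 : F))) :
    fiveIsogeny b (1 : F) (ψ Q) = ((5 : ℕ) : ℤ) • Q := by
  obtain ⟨P, rfl⟩ := (fiveIsogeny b (1 : F)).surjective Q
  rw [hψ, map_zsmul]

include hψ in
/-- **`ψ` kills no non-zero `Γ_F`-fixed point** when `μ₅(F) = 1` (hypothesis `hμ`, in the `galRingHom`
spelling): `ker ψ = φ(E[5]) ≅ μ₅`.  If `P = φ S`, `S ∈ E[5]`, is fixed then `e₅(S, T̄)` is fixed, so `= 1`, so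
`S ∈ ⟨T̄⟩ = ker φ`.
[cite: SilvermanAEC2009, Prop. III.8.1 and Exercise 10.1] [cite: Fisher2001FiveSevenDescent, §1] -/
theorem dual_apply_ne_zero_of_fixed
    (hμ : ∀ ζ : AlgebraicClosure F, ζ ^ 5 = 1 → (∀ σ : absoluteGaloisGroup F, galRingHom σ ζ = ζ) → ζ = 1)
    {P : geomPoints (kubertTateFive' b (1 : F))}
    (hPfix : ∀ σ : absoluteGaloisGroup F, σ • P = P) (hP0 : P ≠ 0) : ψ P ≠ 0 := by
  haveI : Fact (Nat.Prime 5) := ⟨Nat.prime_five⟩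
  intro hψP
  set h5 := natCast_level_ne_zero F 5
  set T₀ := Tbar b (1 : F) with hT₀
  have hT : ((5 : ℕ) : ℤ) • T₀ = 0 := five_zsmul_Tbar b 1
  have hker := ker_fiveIsogeny_eq_zmultiples b (1 : F)
  have hmem : P ∈ ψ.toAddMonoidHom.ker := hψP
  obtain ⟨S, hS5, hSP⟩ := (mem_ker_dual_iff (fiveIsogeny b (1 : F)) ψ hψ P).mp hmem
  have hS : ((5 : ℕ) : ℤ) • S = 0 := by
    rw [natCast_zsmul]; exact AddSubgroup.torsionBy.nsmul_iff.mp hS5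
  -- `ζ = e₅(S, T̄)` is Galois fixed
  have hζfix : ∀ σ : absoluteGaloisGroup F,
      galRingHom σ (weilPairingFun h5 S T₀) = weilPairingFun h5 S T₀ := by
    intro σ
    have hdiff : σ • S - S ∈ AddSubgroup.zmultiples T₀ := by
      rw [← hker, AddMonoidHom.mem_ker, Isogeny.coe_toAddMonoidHom, map_sub, Isogeny.map_smul, hSP,
        hPfix σ, sub_self]
    have hσS : ((5 : ℕ) : ℤ) • (σ • S) = 0 := by rw [smul_comm, hS, smul_zero]
    have hd5 : ((5 : ℕ) : ℤ) • (σ • S - S) = 0 := by rw [smul_sub, hσS, hS, sub_self]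
    have h2 : σ • S = S + (σ • S - S) := by abel
    have hσT : σ • T₀ = T₀ := smul_Tbar b (1 : F) σ
    rw [galRingHom_apply, ← weilPairingFun_smul h5 σ hS hT, hσT, h2,
      weilPairingFun_add_left h5 hS hd5 hT, weilPairingFun_eq_one_of_mem_zmultiples hT hdiff, mul_one]
  have hζ5 : weilPairingFun h5 S T₀ ^ 5 = 1 := weilPairingFun_pow h5 hS hT
  have hζ1 : weilPairingFun h5 S T₀ = 1 := hμ _ hζ5 hζfix
  have hSmem := mem_zmultiples_of_weilPairingFun_eq_one hT (Tbar_ne_zero b 1) hS hζ1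
  rw [← hker, AddMonoidHom.mem_ker, Isogeny.coe_toAddMonoidHom, hSP] at hSmem
  exact hP0 hSmem

omit hE in
/-- Two affine points with equal coordinates are equal (proof-irrelevant form). [folklore] -/
private theorem some_eq_some_of_eq {R : Type*} [CommRing R] {V : WeierstrassCurve R}
    {x y x' y' : R} (hx : x = x') (hy : y = y') (h : V.toAffine.Nonsingular x y)
    (h' : V.toAffine.Nonsingular x' y') : Affine.Point.some x y h = Affine.Point.some x' y' h' := by
  subst hx hy; rfl

/-- **`−T̄ = (0, b)`** on `E_{b,1}` (`−(x,y) = (x, −y − a₁x − a₃)`, `a₃ = −b`). [cite: Knapp1993, §V.5 (5.30)] -/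
theorem neg_Tbar_eq : ∃ h', -Tbar b (1 : F) =
    Affine.Point.some 0 (algebraMap F (AlgebraicClosure F) b) h' := by
  have h₁ := (nonsingular_candidates b (1 : F)).1
  have hneg : ((kubertTateFive b (1 : F)).baseChange (AlgebraicClosure F)).toAffine.negY 0 0 =
      algebraMap F (AlgebraicClosure F) b := by
    rw [KubertTateKummer.baseChange_eq]
    simp [Affine.negY]
  have h' : ((kubertTateFive b (1 : F)).baseChange (AlgebraicClosure F)).toAffine.Nonsingular 0
      (algebraMap F (AlgebraicClosure F) b) := by
    simpa using h₁
  refine ⟨h', ?_⟩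
  rw [Tbar_eq]
  change -(Affine.Point.some 0 0 (KubertTateKummer.nonsingular_zero_zero b (1 : F)) :
      ((kubertTateFive b (1 : F)).baseChange (AlgebraicClosure F)).toAffine.Point) = _
  rw [Affine.Point.neg_some]
  exact some_eq_some_of_eq rfl hneg _ _

/-- **`2T̄ = (b, y)` with `y ∈ {0, b²}`** on `E_{b,1}`: `2T̄ ∈ ker φ ∖ {O, T̄, −T̄}` and the kernel coordinates
(`mem_ker_fiveIsogeny_imp`). [cite: Velu1971, formulae] [cite: Knapp1993, §V.5 (5.30)] -/
theorem two_nsmul_Tbar_eq : ∃ (y : AlgebraicClosure F) (h : _), (2 : ℕ) • Tbar b (1 : F) =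
    Affine.Point.some (algebraMap F (AlgebraicClosure F) b) y h ∧
      (y = 0 ∨ y = algebraMap F (AlgebraicClosure F) b ^ 2) := by
  set T₀ := Tbar b (1 : F) with hT₀
  have hord := addOrderOf_Tbar b (1 : F)
  have h2ne0 : (2 : ℕ) • T₀ ≠ 0 := fun e ↦ by
    have := addOrderOf_dvd_iff_nsmul_eq_zero.mpr e
    rw [hord] at this
    omega
  have h3ne0 : (3 : ℕ) • T₀ ≠ 0 := fun e ↦ by
    have := addOrderOf_dvd_iff_nsmul_eq_zero.mpr e
    rw [hord] at this
    omega
  have h2neT : (2 : ℕ) • T₀ ≠ T₀ := fun e ↦ by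
    rw [two_nsmul, add_eq_left] at e
    exact Tbar_ne_zero b 1 e
  have h2neN : (2 : ℕ) • T₀ ≠ -T₀ := fun e ↦ by
    apply h3ne0
    rw [succ_nsmul, e, neg_add_cancel]
  have hmem : (2 : ℕ) • T₀ ∈ (fiveIsogeny b (1 : F)).toAddMonoidHom.ker :=
    AddSubgroup.nsmul_mem _ (Tbar_mem_ker b 1) 2
  obtain ⟨h₂, e₂⟩ := neg_Tbar_eq b
  rcases mem_ker_fiveIsogeny_imp b (1 : F) (show fiveIsogeny b (1 : F) ((2 : ℕ) • T₀) = 0 from hmem) with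
    e | ⟨x, y, h, e, ⟨hx, hy | hy⟩ | ⟨hx, hy⟩⟩
  · exact absurd e h2ne0
  · exfalso; apply h2neT
    rw [e, hT₀, Tbar_eq]
    exact some_eq_some_of_eq hx hy _ _
  · exfalso; apply h2neN
    rw [e, e₂]
    exact some_eq_some_of_eq hx (by rw [hy]; simp) _ _
  · have hx' : x = algebraMap F (AlgebraicClosure F) b := by rw [hx]; simp
    subst hx'
    refine ⟨y, h, e, ?_⟩
    rcases hy with hy | hy
    · exact Or.inl hy
    · right; rw [hy]; simp

include hψ in
/-- **The Kummer step E-es-242 on the Tate normal form**: if `E'_{b,1} = veluFive b` has a rational point of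
order `5` then `b ∈ ℚ⁵`. [cite: SilvermanAEC2009, Exercise 10.1(c) and Thm. X.1.1(c)] [cite: Fisher2001FiveSevenDescent, §1] -/
theorem exists_eq_pow_five_of_dual [DecidableEq F]
    (hμ : ∀ ζ : AlgebraicClosure F, ζ ^ 5 = 1 → (∀ σ : absoluteGaloisGroup F, galRingHom σ ζ = ζ) → ζ = 1)
    (P' : (kubertTateFive' b (1 : F)).toAffine.Point) (hP' : addOrderOf P' = 5) :
    ∃ s : F, b = s ^ 5 := by
  haveI : Fact (Nat.Prime 5) := ⟨Nat.prime_five⟩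
  obtain ⟨hb0, -, -⟩ := ne_zero_of_isElliptic b (1 : F)
  set h5 := natCast_level_ne_zero F 5
  have hφψ := fiveIsogeny_dual_apply b ψ hψ
  -- the geometric point `P = ι P'`
  set P := toGeomPoints (kubertTateFive' b (1 : F)) P' with hP
  have hPfix : ∀ σ : absoluteGaloisGroup F, σ • P = P := fun σ ↦ smul_toGeomPoints _ σ P'
  have hordP : addOrderOf P = 5 := by rw [hP, addOrderOf_toGeomPoints_eq, hP']
  have hP0 : P ≠ 0 := by
    intro e; rw [e, addOrderOf_zero] at hordP; omega
  have h5P : ((5 : ℕ) : ℤ) • P = 0 := by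
    rw [natCast_zsmul, ← hordP]; exact addOrderOf_nsmul_eq_zero P
  -- `Q = ψ P` generates `ker φ = ⟨T̄⟩`
  set T₀ := Tbar b (1 : F) with hT₀
  have hT : ((5 : ℕ) : ℤ) • T₀ = 0 := five_zsmul_Tbar b 1
  have hker := ker_fiveIsogeny_eq_zmultiples b (1 : F)
  set Q := ψ P with hQ
  have hQ0 : Q ≠ 0 := dual_apply_ne_zero_of_fixed b ψ hψ hμ hPfix hP0
  have hQmem : Q ∈ (fiveIsogeny b (1 : F)).toAddMonoidHom.ker := by
    rw [AddMonoidHom.mem_ker, Isogeny.coe_toAddMonoidHom, hQ, hφψ, h5P]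
  have hgen : (fiveIsogeny b (1 : F)).toAddMonoidHom.ker = AddSubgroup.zmultiples Q := by
    haveI : Finite (fiveIsogeny b (1 : F)).toAddMonoidHom.ker := (fiveIsogeny b (1 : F)).finite_ker'
    have hle : AddSubgroup.zmultiples Q ≤ (fiveIsogeny b (1 : F)).toAddMonoidHom.ker :=
      AddSubgroup.zmultiples_le.mpr hQmem
    have hordQ : addOrderOf Q = 5 := addOrderOf_eq_prime (five_nsmul_eq_zero_of_mem_ker b 1 hQmem) hQ0
    refine (AddSubgroup.eq_of_le_of_card_ge hle ?_).symm
    rw [natCard_ker_fiveIsogeny, Nat.card_zmultiples, hordQ]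
  -- the two evaluation points `2T̄ = (b, y₁)`, `−T̄ = (0, b)` and their `[5]`-preimages `R₁`, `R₂`
  obtain ⟨y₁, h₁, e₁, hy₁⟩ := two_nsmul_Tbar_eq b
  obtain ⟨h₂, e₂⟩ := neg_Tbar_eq b
  have hm₁ : (2 : ℕ) • T₀ ∈ AddSubgroup.zmultiples Q := hgen ▸ AddSubgroup.nsmul_mem _ (Tbar_mem_ker b 1) 2
  have hm₂ : -T₀ ∈ AddSubgroup.zmultiples Q := hgen ▸ AddSubgroup.neg_mem _ (Tbar_mem_ker b 1)
  obtain ⟨a₁, ha₁⟩ := AddSubgroup.mem_zmultiples_iff.mp hm₁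
  obtain ⟨a₂, ha₂⟩ := AddSubgroup.mem_zmultiples_iff.mp hm₂
  obtain ⟨R₁, hR₁⟩ := (fiveIsogeny b (1 : F)).surjective (a₁ • P)
  obtain ⟨R₂, hR₂⟩ := (fiveIsogeny b (1 : F)).surjective (a₂ • P)
  have h5R₁ : ((5 : ℕ) : ℤ) • R₁ = (2 : ℕ) • T₀ := by rw [← hψ R₁, hR₁, map_zsmul, ← hQ, ha₁]
  have h5R₂ : ((5 : ℕ) : ℤ) • R₂ = -T₀ := by rw [← hψ R₂, hR₂, map_zsmul, ← hQ, ha₂]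
  -- hypotheses of the Kummer lemma
  have hord := addOrderOf_Tbar b (1 : F)
  have h2ne0 : (2 : ℕ) • T₀ ≠ 0 := fun e ↦ by
    have := addOrderOf_dvd_iff_nsmul_eq_zero.mpr e
    rw [hord] at this
    omega
  have h2neT : (2 : ℕ) • T₀ ≠ T₀ := fun e ↦ by
    rw [two_nsmul, add_eq_left] at e
    exact Tbar_ne_zero b 1 e
  have hNne0 : -T₀ ≠ 0 := neg_ne_zero.mpr (Tbar_ne_zero b 1)
  have hNneT : -T₀ ≠ T₀ := fun e ↦ h2ne0 (by rw [two_nsmul]; nth_rw 1 [← e]; exact neg_add_cancel T₀)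
  have hcoc : ∀ (R : geomPoints (kubertTateFive b (1 : F))) (a : ℤ), fiveIsogeny b (1 : F) R = a • P →
      ∀ σ : absoluteGaloisGroup F, weilPairingFun h5 (σ • R - R) T₀ = 1 := by
    intro R a hR σ
    apply weilPairingFun_eq_one_of_mem_zmultiples hT
    rw [← hker, AddMonoidHom.mem_ker, Isogeny.coe_toAddMonoidHom, map_sub, Isogeny.map_smul, hR, smul_comm,
      hPfix σ, sub_self]
  have hpair : ∀ σ : absoluteGaloisGroup F,
      weilPairingFun h5 (σ • R₁ - R₁) T₀ = weilPairingFun h5 (σ • R₂ - R₂) T₀ := fun σ ↦ by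
    rw [hcoc R₁ a₁ hR₁ σ, hcoc R₂ a₂ hR₂ σ]
  have hR₁fix : ∀ σ : absoluteGaloisGroup F, σ • (((5 : ℕ) : ℤ) • R₁) = ((5 : ℕ) : ℤ) • R₁ := fun σ ↦ by
    rw [h5R₁, smul_comm, smul_Tbar]
  have hR₂fix : ∀ σ : absoluteGaloisGroup F, σ • (((5 : ℕ) : ℤ) • R₂) = ((5 : ℕ) : ℤ) • R₂ := fun σ ↦ by
    rw [h5R₂, smul_neg, smul_Tbar]
  -- values of `f_T = xy − x² + y`
  set ι := algebraMap F (AlgebraicClosure F) with hι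
  have hv₁ : (kubertTateFive b (1 : F)).HasValueAt (kummerFn b (1 : F)) (((5 : ℕ) : ℤ) • R₁)
      (ι b * y₁ - ι b ^ 2 + y₁) := by
    rw [h5R₁, e₁]
    simpa using hasValueAt_kummerFn b (1 : F) h₁
  have hv₂ : (kubertTateFive b (1 : F)).HasValueAt (kummerFn b (1 : F)) (((5 : ℕ) : ℤ) • R₂) (ι b) := by
    rw [h5R₂, e₂]
    simpa using hasValueAt_kummerFn b (1 : F) h₂
  obtain ⟨u, hu0, hu⟩ := exists_pow_mul_eq_of_weilPairing_eq' hT (smul_Tbar b (1 : F)) (kummerFn_ne_zero b 1)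
    (ord_kummerFn b (1 : F)) (by rw [h5R₁]; exact h2ne0) (by rw [h5R₁]; exact h2neT) hR₁fix
    (by rw [h5R₂]; exact hNne0) (by rw [h5R₂]; exact hNneT) hR₂fix hpair hv₁ hv₂
  -- read off `b`
  rcases hy₁ with hy | hy
  · -- `2T̄ = (b, 0)`: `−b² = u⁵ b`, `b = (−u)⁵`
    rw [hy, mul_zero, add_zero, zero_sub, ← map_pow, ← map_pow, ← map_neg, ← map_mul] at hu
    have hu' := ι.injective hu
    refine ⟨-u, ?_⟩
    have : -b = u ^ 5 := mul_right_cancel₀ hb0 (by linear_combination hu')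
    linear_combination -this
  · -- `2T̄ = (b, b²)`: `b³ = u⁵ b`, `b² = u⁵`, `b = (b/u²)⁵`
    rw [hy, ← map_pow, ← map_pow, ← map_mul, ← map_sub, ← map_add, ← map_mul] at hu
    have hu' := ι.injective hu
    have hb2 : b ^ 2 = u ^ 5 := mul_right_cancel₀ hb0 (by linear_combination hu')
    refine ⟨b / u ^ 2, ?_⟩
    rw [div_pow, eq_div_iff (pow_ne_zero _ (pow_ne_zero _ hu0))]
    linear_combination (-(b ^ 3) - b * u ^ 5) * hb2

end TateNormalForm

/-! ## §3 E-es-242, E-es-239 and L5 over `ℚ` -/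

/-- `μ₅(ℚ) = 1` in `ℚ̄`, `galRingHom` spelling: a fifth root of unity fixed by `Γ_ℚ` is rational (Galois descent),
and `x ↦ x⁵` is injective on `ℚ`. [cite: Washington1997, Lemma 1.2 and Thm. 2.5] -/
theorem eq_one_of_pow_five_eq_one_of_forall_galRingHom (ζ : AlgebraicClosure ℚ) (hζ5 : ζ ^ 5 = 1)
    (hfix : ∀ σ : absoluteGaloisGroup ℚ, galRingHom σ ζ = ζ) : ζ = 1 := by
  obtain ⟨c, hc⟩ := exists_algebraMap_of_forall_galRingHom hfix
  have hc5 : c ^ 5 = 1 := by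
    have h := congrArg (· ^ 5) hc
    rw [← map_pow, hζ5] at h
    exact (map_eq_one_iff _ (RingHom.injective _)).mp h
  have hc1 : c = 1 := by
    have hodd : Odd 5 := by decide
    exact (hodd.strictMono_pow (R := ℚ)).injective (by simpa using hc5)
  rw [← hc, hc1, map_one]

/-- `E'_{b,1}` elliptic forces `b ≠ 0` (`Δ' = b(b² − 11b − 1)⁵`). [cite: Velu1971, formulae] -/
theorem ne_zero_of_isElliptic_kubertTateFive' {b : ℚ} (h : (kubertTateFive' b (1 : ℚ)).IsElliptic) : b ≠ 0 := by
  rintro rfl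
  have := h.isUnit.ne_zero
  rw [kubertTateFive'_Δ] at this
  exact this (by ring)

/-- **PROOF OF ITEM E-es-242 `VeluFiveRationalFiveTorsion`**: a rational point of order `5` on an elliptic
`veluFive b` forces `b ∈ ℚ⁵`. [cite: SilvermanAEC2009, Exercise 10.1(c), Thm. X.1.1(c), Prop. X.4.9]
[cite: Fisher2001FiveSevenDescent, §1] -/
theorem veluFiveRationalFiveTorsion_holds : VeluFiveRationalFiveTorsion := by
  intro b hW hP
  have key : ∀ V : WeierstrassCurve ℚ, V = kubertTateFive' b (1 : ℚ) → V.IsElliptic →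
      (∃ P : V.toAffine.Point, addOrderOf P = 5) → ∃ s : ℚ, b = s ^ 5 := by
    intro V hV hVe hVP
    subst hV
    obtain ⟨P, hP5⟩ := hVP
    haveI : (kubertTateFive b (1 : ℚ)).IsElliptic :=
      isElliptic_kubertTateFive_rat (ne_zero_of_isElliptic_kubertTateFive' hVe) one_ne_zero
    obtain ⟨ψ, hψ⟩ := exists_dual_fiveIsogeny b
    exact exists_eq_pow_five_of_dual b ψ hψ eq_one_of_pow_five_eq_one_of_forall_galRingHom P hP5
  exact key _ (veluFive_eq_kubertTateFive' b) hW hP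

/-- **E-es-239 `SplitFiveTorsionModuli` is a theorem**: a rational `5`-point with split `5`-torsion forces
`E ≅ veluFive (s⁵)` over `ℚ` — from E-es-241 (`splitFiveTorsionIsVeluQuotient_holds`, part 8) and E-es-242.
[cite: SilvermanAEC2009, Prop. X.4.9] [cite: Fisher2001FiveSevenDescent, §1] -/
theorem splitFiveTorsionModuli_holds : SplitFiveTorsionModuli :=
  splitFiveTorsionModuli_of splitFiveTorsionIsVeluQuotient_holds veluFiveRationalFiveTorsion_holds

/-- **L5 = E-es-235 `SplitFiveTorsionRootNumberLaw` is a theorem**: for `E/ℚ` with a rational `5`-torsion point and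
split `5`-torsion, additive reduction at `5` forces `w₅(E) = −1` (Kodaira III on the split stratum `E ≅ veluFive (s⁵)`;
E-es-238 `veluFiveFamilyRootNumberLaw_holds` through the landed edge `splitFiveTorsionRootNumberLaw_of_split`).
[cite: Rohrlich1993Compositio, Prop. 2] [cite: Kubert1976, Table 3] -/
theorem splitFiveTorsionRootNumberLaw_holds : EsG43.SplitFiveTorsionRootNumberLaw :=
  splitFiveTorsionRootNumberLaw_of_split splitFiveTorsionIsVeluQuotient_holds veluFiveRationalFiveTorsion_holds

end Summit.BirchSwinnertonDyer.BirchSwinnertonDyer.Theorems.ManinLocalTwoThree.ShimuraFive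

end
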